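import Summits.CriticalPhenomena.Ising3D.Control2DChiralMono
import Mathlib.Analysis.Convex.Mul
import Mathlib.Analysis.Convex.Function
import Mathlib.Tactic.Linarith
import Mathlib.Tactic.Positivity
import Mathlib.Tactic.FieldSimp
import Mathlib.Tactic.Ring
import HarnessLib

/-!
# The 2D control: the chiral coefficients `a_m(h)` are CONVEX in `h` (and so are the truncated blocks)
(cell `pub-ising3x`, seat controls-1; mathematics for the second-order upgrade of the kernel (C) scheme)

HONEST FRAMING: lottery ticket; floor = tightest certified 3D Ising CFT bounds; no exact-solution
claim without a proof.

`Control2DChiralMono.lean` gives `a_m(h) = ∏_{i<m} φ_i(h)` non-negative and non-decreasing on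
`h ≥ 0`. Here: each factor is also CONVEX on `h ≥ 0` — `φ_0(h) = h/2` is affine and, for `i ≥ 1`,
`φ_i(h) = (h+i)²/((i+1)(2h+i)) = ((2h+i) + 2i)/(4(i+1)) + (i²/(4(i+1)))/(2h+i)`, an affine function
plus a non-negative multiple of `1/(2h+i)` (`one_div_affine_convex`: `1/(aX+bY) ≤ a/X + b/Y`) — hence the
product of non-negative, non-decreasing, convex factors is convex (`ConvexOn.mul` with monovarying
factors): **`convexOn_chiralCoeff`**. Consequently the truncated chiral series `AN N h v` (`v ≥ 0`) is
convex in `h`, and the block factor `brR N ℓ Δ x y` (`x, y > 0`) is convex in `Δ` on `Δ ≥ ℓ`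
(`convexOn_AN`, `convexOn_brR`). With convexity, the kernel cell scheme for obligation (C) can bound the
block factor by its left secant (positives) and its chord (negatives) — second order in BOTH factors —
which is what the sharper 2D certificates (`Δ_ε < 1.02, 1.01`, the `c`-bound certificate touching zero at
`Δ_ε = 1`) require (SCOPE §4 `### controls-1 v6`, reading (iii)). This file is the mathematics only.

References: Dolan–Osborn 2004 §3 (blocks); Mathlib `ConvexOn.mul`, `MonotoneOn.monovaryOn`. [folklore]
-/

namespace Summit.CriticalPhenomena.Ising3D.Control2D

open Set Finset
open Literature.MathematicalPhysics.QuantumFieldTheory.ConformalBootstrap3D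

/-! ### Convexity of the factors -/

/-- The harmonic–arithmetic inequality behind the convexity of `1/x`: for `X, Y > 0` and convex weights
`a, b`, `1/(aX+bY) ≤ a/X + b/Y`. [folklore] -/
theorem one_div_convex_comb {X Y a b : ℝ} (hX : 0 < X) (hY : 0 < Y) (ha : 0 ≤ a) (hb : 0 ≤ b)
    (hab : a + b = 1) : 1 / (a * X + b * Y) ≤ a / X + b / Y := by
  have hS : 0 < a * X + b * Y := by
    rcases le_total X Y with h | h
    · nlinarith
    · nlinarith
  rw [div_add_div _ _ hX.ne' hY.ne', div_le_div_iff₀ hS (mul_pos hX hY)]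
  have hb' : b = 1 - a := by linarith
  subst hb'
  nlinarith [mul_nonneg (mul_nonneg ha hb) (sq_nonneg (X - Y)), mul_pos hX hY]

/-- `h ↦ K/(2h+i)` is convex on `h ≥ 0` for `K ≥ 0`, `i > 0`. [folklore] -/
theorem convexOn_const_div_affine {K i : ℝ} (hK : 0 ≤ K) (hi : 0 < i) :
    ConvexOn ℝ (Ici (0 : ℝ)) (fun h => K / (2 * h + i)) := by
  refine ⟨convex_Ici 0, fun x hx y hy a b ha hb hab => ?_⟩
  have hx' : (0 : ℝ) ≤ x := hx
  have hy' : (0 : ℝ) ≤ y := hy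
  have hX : 0 < 2 * x + i := by linarith
  have hY : 0 < 2 * y + i := by linarith
  have key := one_div_convex_comb hX hY ha hb hab
  have e : a * (2 * x + i) + b * (2 * y + i) = 2 * (a * x + b * y) + i := by
    have : a * i + b * i = i := by rw [← add_mul, hab, one_mul]
    linarith
  rw [e] at key
  simp only [smul_eq_mul]
  have := mul_le_mul_of_nonneg_left key hK
  calc K / (2 * (a * x + b * y) + i) = K * (1 / (2 * (a * x + b * y) + i)) := by ring
    _ ≤ K * (a / (2 * x + i) + b / (2 * y + i)) := this
    _ = a * (K / (2 * x + i)) + b * (K / (2 * y + i)) := by ring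

/-- **Each factor `φ_i` is convex on `h ≥ 0`.** [folklore] -/
theorem convexOn_chiralFactor (i : ℕ) : ConvexOn ℝ (Ici (0 : ℝ)) (chiralFactor i) := by
  by_cases hi : i = 0
  · subst hi
    refine ⟨convex_Ici 0, fun x _ y _ a b _ _ _ => ?_⟩
    simp [chiralFactor]
    ring_nf; rfl
  · have hi1 : (0 : ℝ) < i := by
      have : 1 ≤ i := Nat.one_le_iff_ne_zero.mpr hi
      exact_mod_cast Nat.lt_of_lt_of_le Nat.zero_lt_one this
    have hK : (0 : ℝ) ≤ (i : ℝ) ^ 2 / (4 * ((i : ℝ) + 1)) := by positivity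
    have hconv := convexOn_const_div_affine hK hi1
    -- φ_i = affine + K/(2h+i) on h ≥ 0
    have hrepr : EqOn (fun h : ℝ => ((2 * h + i) + 2 * i) / (4 * ((i : ℝ) + 1)) +
        ((i : ℝ) ^ 2 / (4 * ((i : ℝ) + 1))) / (2 * h + i)) (chiralFactor i) (Ici (0 : ℝ)) := by
      intro h hh
      have hh' : (0 : ℝ) ≤ h := hh
      have h2 : 2 * h + (i : ℝ) ≠ 0 := by linarith
      have h4 : (4 : ℝ) * ((i : ℝ) + 1) ≠ 0 := by positivity
      simp only [chiralFactor, hi, ↓reduceIte]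
      field_simp
      ring
    refine ConvexOn.congr ?_ hrepr
    have haff : ConvexOn ℝ (Ici (0 : ℝ)) (fun h : ℝ => ((2 * h + i) + 2 * i) / (4 * ((i : ℝ) + 1))) := by
      refine ⟨convex_Ici 0, fun x _ y _ a b _ _ hab => ?_⟩
      simp only [smul_eq_mul]
      have : a * (i : ℝ) + b * i = i := by rw [← add_mul, hab, one_mul]
      have h4 : (0 : ℝ) < 4 * ((i : ℝ) + 1) := by positivity
      apply le_of_eq
      field_simp
      linear_combination (-3 : ℝ) * this
    exact haff.add hconv

/-! ### Convexity of `a_m(h)` -/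

/-- `chiralProd · m` is monotone on `h ≥ 0` (restated as `MonotoneOn`). [folklore] -/
theorem monotoneOn_chiralProd (m : ℕ) : MonotoneOn (fun h => chiralProd h m) (Ici (0 : ℝ)) :=
  fun _ hx _ _ hxy => chiralProd_mono hx hxy m

/-- `φ_i` is monotone on `h ≥ 0` (restated as `MonotoneOn`). [folklore] -/
theorem monotoneOn_chiralFactor (i : ℕ) : MonotoneOn (chiralFactor i) (Ici (0 : ℝ)) :=
  fun _ hx _ _ hxy => chiralFactor_mono i hx hxy

/-- **The product form is convex on `h ≥ 0`** (induction: product of non-negative, monotone, convex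
factors, `ConvexOn.mul`). [folklore] -/
theorem convexOn_chiralProd : ∀ m : ℕ, ConvexOn ℝ (Ici (0 : ℝ)) (fun h => chiralProd h m)
  | 0 => by
    simp only [chiralProd, range_zero]
    exact convexOn_const 1 (convex_Ici 0)
  | m + 1 => by
    have ih := convexOn_chiralProd m
    have hmul := ih.mul (convexOn_chiralFactor m) (fun x hx => chiralProd_nonneg hx m)
      (fun x hx => chiralFactor_nonneg m hx) ((monotoneOn_chiralProd m).monovaryOn (monotoneOn_chiralFactor m))
    refine hmul.congr fun h _ => ?_
    simp only [Pi.mul_apply, chiralProd, prod_range_succ]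

/-- **`a_m(h)` is convex on `h ≥ 0`.** [folklore] -/
theorem convexOn_chiralCoeff (m : ℕ) : ConvexOn ℝ (Ici (0 : ℝ)) (fun h => chiralCoeff h m) :=
  (convexOn_chiralProd m).congr fun _ hh => (chiralCoeff_eq_prod hh m).symm

/-! ### Convexity of the truncated series and of the block factor -/

/-- A finite sum of convex functions is convex. [folklore] -/
theorem convexOn_finset_sum {ι : Type} (S : Finset ι) {s : Set ℝ} (hs : Convex ℝ s) (f : ι → ℝ → ℝ)
    (hf : ∀ i ∈ S, ConvexOn ℝ s (f i)) : ConvexOn ℝ s (fun x => ∑ i ∈ S, f i x) := by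
  classical
  induction S using Finset.induction_on with
  | empty => simpa using convexOn_const (0 : ℝ) hs
  | insert a S ha ih =>
    have h1 : ConvexOn ℝ s (f a) := hf a (mem_insert_self a S)
    have h2 := ih fun i hi => hf i (mem_insert_of_mem hi)
    have := h1.add h2
    refine this.congr fun x _ => ?_
    simp [Finset.sum_insert ha]

/-- **`AN N h v` is convex in `h ≥ 0`** for `v ≥ 0`. [folklore] -/
theorem convexOn_AN (N : ℕ) {v : ℝ} (hv : 0 ≤ v) : ConvexOn ℝ (Ici (0 : ℝ)) (fun h => AN N h v) := by
  unfold AN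
  refine convexOn_finset_sum (range N) (convex_Ici 0) (fun m h => chiralCoeff h m * v ^ m) fun m _ => ?_
  have := (convexOn_chiralCoeff m).smul (pow_nonneg hv m)
  refine this.congr fun _ _ => ?_
  simp [smul_eq_mul, mul_comm]

/-- `AN N · v` is monotone on `h ≥ 0` (restated). [folklore] -/
theorem monotoneOn_AN (N : ℕ) {v : ℝ} (hv : 0 ≤ v) : MonotoneOn (fun h => AN N h v) (Ici (0 : ℝ)) :=
  fun _ hx _ _ hxy => AN_mono N hx hxy hv

/-- Pre-composition with the increasing affine map `Δ ↦ (Δ + c)/2` (into `h ≥ 0`) preserves convexity: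
used with `c = ℓ` and `c = -ℓ` on `Δ ≥ ℓ`. [folklore] -/
theorem ConvexOn.comp_half_shift {F : ℝ → ℝ} (hF : ConvexOn ℝ (Ici (0 : ℝ)) F) (t₀ c : ℝ)
    (h0 : 0 ≤ (t₀ + c) / 2) : ConvexOn ℝ (Ici t₀) (fun x => F ((x + c) / 2)) := by
  refine ⟨convex_Ici t₀, fun x hx y hy a b ha hb hab => ?_⟩
  have hx' : t₀ ≤ x := hx
  have hy' : t₀ ≤ y := hy
  have mx : (x + c) / 2 ∈ Ici (0 : ℝ) := by show (0 : ℝ) ≤ _; linarith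
  have my : (y + c) / 2 ∈ Ici (0 : ℝ) := by show (0 : ℝ) ≤ _; linarith
  have key := hF.2 mx my ha hb hab
  have e : a • ((x + c) / 2) + b • ((y + c) / 2) = (a • x + b • y + c) / 2 := by
    simp only [smul_eq_mul]
    have : a * c + b * c = c := by rw [← add_mul, hab, one_mul]
    linarith
  rw [e] at key
  exact key

/-- The same for monotonicity. [folklore] -/
theorem MonotoneOn.comp_half_shift {F : ℝ → ℝ} (hF : MonotoneOn F (Ici (0 : ℝ))) (t₀ c : ℝ)
    (h0 : 0 ≤ (t₀ + c) / 2) : MonotoneOn (fun x => F ((x + c) / 2)) (Ici t₀) := by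
  intro x hx y hy hxy
  have hx' : t₀ ≤ x := hx
  have hy' : t₀ ≤ y := hy
  exact hF (show (0 : ℝ) ≤ (x + c) / 2 by linarith) (show (0 : ℝ) ≤ (y + c) / 2 by linarith)
    (by linarith)

/-- **The block factor `brR N ℓ Δ x y` is convex in `Δ` on `Δ ≥ ℓ`** (`x, y > 0`): each summand is a
non-negative constant times a product of two non-negative, non-decreasing, convex functions of `Δ`.
[folklore] -/
theorem convexOn_brR (N ℓ : ℕ) {x y : ℝ} (hx : 0 < x) (hy : 0 < y) :
    ConvexOn ℝ (Ici (ℓ : ℝ)) (fun Δ => brR N ℓ Δ x y) := by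
  have h0p : (0 : ℝ) ≤ ((ℓ : ℝ) + ℓ) / 2 := by positivity
  have h0m : (0 : ℝ) ≤ ((ℓ : ℝ) + -(ℓ : ℝ)) / 2 := by norm_num
  -- the four reparametrised series
  have cAx := ConvexOn.comp_half_shift (convexOn_AN N hx.le) (ℓ : ℝ) ℓ h0p
  have cAy := ConvexOn.comp_half_shift (convexOn_AN N hy.le) (ℓ : ℝ) (-(ℓ : ℝ)) h0m
  have cBx := ConvexOn.comp_half_shift (convexOn_AN N hx.le) (ℓ : ℝ) (-(ℓ : ℝ)) h0m
  have cBy := ConvexOn.comp_half_shift (convexOn_AN N hy.le) (ℓ : ℝ) ℓ h0p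
  have mAx := MonotoneOn.comp_half_shift (monotoneOn_AN N hx.le) (ℓ : ℝ) ℓ h0p
  have mAy := MonotoneOn.comp_half_shift (monotoneOn_AN N hy.le) (ℓ : ℝ) (-(ℓ : ℝ)) h0m
  have mBx := MonotoneOn.comp_half_shift (monotoneOn_AN N hx.le) (ℓ : ℝ) (-(ℓ : ℝ)) h0m
  have mBy := MonotoneOn.comp_half_shift (monotoneOn_AN N hy.le) (ℓ : ℝ) ℓ h0p
  have nn : ∀ (v : ℝ), 0 ≤ v → ∀ (c : ℝ), 0 ≤ ((ℓ : ℝ) + c) / 2 →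
      ∀ ⦃Δ : ℝ⦄, Δ ∈ Ici (ℓ : ℝ) → 0 ≤ AN N ((Δ + c) / 2) v := by
    intro v hv c hc Δ hΔ
    have hΔ' : (ℓ : ℝ) ≤ Δ := hΔ
    exact AN_nonneg N (by linarith) hv
  have p1 := cAx.mul cAy (nn x hx.le ℓ h0p) (nn y hy.le (-(ℓ : ℝ)) h0m) (mAx.monovaryOn mAy)
  have p2 := cBx.mul cBy (nn x hx.le (-(ℓ : ℝ)) h0m) (nn y hy.le ℓ h0p) (mBx.monovaryOn mBy)
  have r1 : 0 ≤ (x / y) ^ (ℓ / 2) := by positivity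
  have r2 : 0 ≤ (y / x) ^ (ℓ / 2) := by positivity
  have := (p1.smul r1).add (p2.smul r2)
  refine this.congr fun Δ _ => ?_
  simp only [brR, Pi.add_apply, Pi.mul_apply, smul_eq_mul, sub_eq_add_neg]
  ring

end Summit.CriticalPhenomena.Ising3D.Control2D
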